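import Mathlib
import Literature.NumberTheory.Transcendental.RoyCriterion
import Literature.NumberTheory.Transcendental.RoyCriterionProofs
import HarnessLib

/-!
# Congruence collapse of Roy's derivation: `D^p ≡ X₁∂₁ (mod p)`

Roy's derivation on `ℤ[X₀,X₁]` is `D = ∂₀ + E` with `∂₀ = ∂/∂X₀` and `E = X₁∂/∂X₁`
(`Literature…royD`).  The two summands COMMUTE (they act on different variables), so
`D^p = Σ_j C(p,j) ∂₀^j E^{p−j}`; for a prime `p` the middle binomials vanish mod `p`,
`∂₀^p (X₀^a X₁^b) = a(a−1)⋯(a−p+1)·X₀^{a−p}X₁^b ≡ 0` (a product of `p` consecutive integers) and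
`E^p (X₀^a X₁^b) = b^p X₀^aX₁^b ≡ b·X₀^aX₁^b = E(X₀^aX₁^b)` (Fermat).  Hence

  `royD^[p] P − X₁·∂₁P ∈ p·ℤ[X₀,X₁]`  for every `P`  (`C_dvd_iterate_royD_sub`).

Consequence recorded in the solo wall (R-A8): the orbit family `{D^kP}_{k ≤ K}` of Roy's
hypothesis spans at most `p²` classes modulo `p` however large `K` is — a structural arithmetic
invariant of the data invisible to every profile criterion.  Only the operator congruence is
formalised here. [this work; elementary]
-/

noncomputable section

open MvPolynomial Finset

namespace Summit.Schanuel.Schanuel.Theorems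

open Literature.NumberTheory.Transcendental

/-- Iterating `∂/∂X₀` on a monomial: `∂₀^k (c·X^s) = c·s₀(s₀−1)⋯(s₀−k+1)·X^{s − k·e₀}`.
[folklore] -/
theorem iterate_pderiv_zero_monomial (k : ℕ) (s : Fin 2 →₀ ℕ) (c : ℤ) :
    (pderiv 0)^[k] (monomial s c) =
      monomial (s - Finsupp.single 0 k) (c * ((s 0).descFactorial k : ℕ)) := by
  induction k with
  | zero => simp
  | succ k ih =>
    rw [Function.iterate_succ_apply', ih, pderiv_monomial, tsub_tsub, ← Finsupp.single_add,
      Nat.descFactorial_succ, Finsupp.tsub_apply, Finsupp.single_eq_same]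
    congr 1
    push_cast
    ring

/-- `E = X₁∂₁` multiplies a monomial by its `X₁`-exponent: `E(c·X^s) = (c·s₁)·X^s`. [folklore] -/
theorem X_one_mul_pderiv_one_monomial (s : Fin 2 →₀ ℕ) (c : ℤ) :
    X 1 * pderiv 1 (monomial s c) = monomial s (c * (s 1 : ℕ)) := by
  rw [pderiv_monomial]
  by_cases h : s 1 = 0
  · simp [h]
  · have hle : Finsupp.single (1 : Fin 2) 1 ≤ s :=
      Finsupp.single_le_iff.mpr (Nat.one_le_iff_ne_zero.mpr h)
    rw [show (X 1 : MvPolynomial (Fin 2) ℤ) = monomial (Finsupp.single 1 1) 1 from rfl,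
      monomial_mul, one_mul, add_tsub_cancel_of_le hle]

/-- Iterating `E = X₁∂₁`: `E^i(c·X^s) = (c·s₁^i)·X^s`. [folklore] -/
theorem iterate_X_one_mul_pderiv_one_monomial (i : ℕ) (s : Fin 2 →₀ ℕ) (c : ℤ) :
    (fun P : MvPolynomial (Fin 2) ℤ => X 1 * pderiv 1 P)^[i] (monomial s c) =
      monomial s (c * ((s 1 : ℕ) : ℤ) ^ i) := by
  induction i with
  | zero => simp
  | succ i ih =>
    rw [Function.iterate_succ_apply', ih, X_one_mul_pderiv_one_monomial, pow_succ, mul_assoc]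

/-- `∂₀` and `E = X₁∂₁` commute on `ℤ[X₀,X₁]`. [folklore] -/
theorem pderiv_zero_X_one_mul_pderiv_one (P : MvPolynomial (Fin 2) ℤ) :
    pderiv 0 (X 1 * pderiv 1 P) = X 1 * pderiv 1 (pderiv 0 P) := by
  induction P using MvPolynomial.induction_on' with
  | monomial s c =>
    rw [X_one_mul_pderiv_one_monomial, pderiv_monomial, pderiv_monomial,
      X_one_mul_pderiv_one_monomial, Finsupp.tsub_apply, Finsupp.single_eq_of_ne (by decide),
      Nat.sub_zero]
    congr 1
    ring
  | add P Q hP hQ => rw [map_add, mul_add, map_add, hP, hQ, map_add, map_add, mul_add]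

/-- **`royD` as the sum of two commuting ℤ-linear operators.**  With `d₀ = ∂₀` and
`E = X₁·∂₁` viewed in `Module.End ℤ ℤ[X₀,X₁]`: `royD^[n] P = ((d₀ + E)^n) P`. [this work] -/
theorem iterate_royD_eq_pow_apply (n : ℕ) (P : MvPolynomial (Fin 2) ℤ) :
    royD^[n] P =
      (((pderiv 0 : Derivation ℤ (MvPolynomial (Fin 2) ℤ) (MvPolynomial (Fin 2) ℤ)).toLinearMap +
          LinearMap.mulLeft ℤ (X 1 : MvPolynomial (Fin 2) ℤ) ∘ₗ
            (pderiv 1 : Derivation ℤ (MvPolynomial (Fin 2) ℤ) (MvPolynomial (Fin 2) ℤ)).toLinearMap)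
        ^ n) P := by
  induction n generalizing P with
  | zero => simp
  | succ n ih =>
    rw [Function.iterate_succ_apply', ih, pow_succ', Module.End.mul_apply]
    simp [royD]

/-- **Congruence collapse of Roy's derivation (solo wall R-A8).**  For every prime `p` and every
`P ∈ ℤ[X₀,X₁]`:  `C p ∣ royD^[p] P − X₁·∂₁P`, i.e. `D^p ≡ X₁∂₁ (mod p)` as operators on
`ℤ[X₀,X₁]`. [this work; elementary: binomial theorem for the commuting pair `(∂₀, X₁∂₁)`,
`p ∣ C(p,j)` for `0<j<p`, `p! ∣ a(a−1)⋯(a−p+1)`, and Fermat `b^p ≡ b`] -/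
theorem C_dvd_iterate_royD_sub {p : ℕ} (hp : p.Prime) (P : MvPolynomial (Fin 2) ℤ) :
    (C (p : ℤ) : MvPolynomial (Fin 2) ℤ) ∣ royD^[p] P - X 1 * pderiv 1 P := by
  haveI := Fact.mk hp
  -- the two commuting operators
  set d₀ : Module.End ℤ (MvPolynomial (Fin 2) ℤ) :=
    (pderiv 0 : Derivation ℤ (MvPolynomial (Fin 2) ℤ) (MvPolynomial (Fin 2) ℤ)).toLinearMap with hd₀
  set E : Module.End ℤ (MvPolynomial (Fin 2) ℤ) :=
    LinearMap.mulLeft ℤ (X 1 : MvPolynomial (Fin 2) ℤ) ∘ₗ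
      (pderiv 1 : Derivation ℤ (MvPolynomial (Fin 2) ℤ) (MvPolynomial (Fin 2) ℤ)).toLinearMap with hE
  have hd₀_apply : ∀ Q, d₀ Q = pderiv 0 Q := fun Q => rfl
  have hE_apply : ∀ Q, E Q = X 1 * pderiv 1 Q := fun Q => rfl
  have hcomm : Commute d₀ E := by
    refine LinearMap.ext fun Q => ?_
    change d₀ (E Q) = E (d₀ Q)
    rw [hE_apply, hd₀_apply, hd₀_apply, hE_apply, pderiv_zero_X_one_mul_pderiv_one]
  -- powers of the operators, applied
  have hd₀_pow : ∀ (j : ℕ) Q, (d₀ ^ j) Q = (pderiv 0)^[j] Q := by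
    intro j Q
    induction j generalizing Q with
    | zero => simp
    | succ j ih => rw [pow_succ', Module.End.mul_apply, ih, Function.iterate_succ_apply', hd₀_apply]
  have hE_pow : ∀ (j : ℕ) Q,
      (E ^ j) Q = (fun R : MvPolynomial (Fin 2) ℤ => X 1 * pderiv 1 R)^[j] Q := by
    intro j Q
    induction j generalizing Q with
    | zero => simp
    | succ j ih => rw [pow_succ', Module.End.mul_apply, ih, Function.iterate_succ_apply', hE_apply]
  -- (a) `C p ∣ ∂₀^p Q` for every `Q`
  have hA : ∀ Q : MvPolynomial (Fin 2) ℤ, (C (p : ℤ) : MvPolynomial (Fin 2) ℤ) ∣ (d₀ ^ p) Q := by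
    intro Q
    induction Q using MvPolynomial.induction_on' with
    | monomial s c =>
      rw [hd₀_pow, iterate_pderiv_zero_monomial]
      obtain ⟨q, hq⟩ : (p : ℤ) ∣ ((s 0).descFactorial p : ℕ) := by
        exact_mod_cast (hp.dvd_factorial.mpr le_rfl).trans (Nat.factorial_dvd_descFactorial _ _)
      refine ⟨monomial (s - Finsupp.single 0 p) (c * q), ?_⟩
      rw [C_mul_monomial, hq]
      congr 1
      ring
    | add Q R hQ hR => rw [map_add]; exact dvd_add hQ hR
  -- (b) `C p ∣ E^p Q − E Q` for every `Q` (Fermat)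
  have hB : ∀ Q : MvPolynomial (Fin 2) ℤ,
      (C (p : ℤ) : MvPolynomial (Fin 2) ℤ) ∣ (E ^ p) Q - E Q := by
    intro Q
    induction Q using MvPolynomial.induction_on' with
    | monomial s c =>
      rw [hE_pow, iterate_X_one_mul_pderiv_one_monomial, hE_apply, X_one_mul_pderiv_one_monomial,
        ← map_sub]
      obtain ⟨q, hq⟩ : (p : ℤ) ∣ ((s 1 : ℕ) : ℤ) ^ p - ((s 1 : ℕ) : ℤ) := by
        refine (ZMod.intCast_zmod_eq_zero_iff_dvd _ p).mp ?_
        push_cast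
        rw [ZMod.pow_card, sub_self]
      refine ⟨monomial s (c * q), ?_⟩
      rw [C_mul_monomial, ← mul_sub, hq]
      congr 1
      ring
    | add Q R hQ hR =>
      rw [map_add, map_add]
      have : (E ^ p) Q + (E ^ p) R - (E Q + E R) = ((E ^ p) Q - E Q) + ((E ^ p) R - E R) := by ring
      rw [this]
      exact dvd_add hQ hR
  -- (c) the binomial expansion of `(d₀ + E)^p`, applied to `P`
  have hbin : royD^[p] P =
      ∑ j ∈ range (p + 1), (p.choose j : ℤ) • (d₀ ^ j) ((E ^ (p - j)) P) := by
    rw [iterate_royD_eq_pow_apply, ← hd₀, ← hE, hcomm.add_pow, LinearMap.sum_apply]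
    refine sum_congr rfl fun j _ => ?_
    rw [Module.End.mul_apply, Module.End.mul_apply, Module.End.natCast_apply, map_nsmul, map_nsmul,
      Nat.cast_smul_eq_nsmul]
  -- middle terms: `p ∣ C(p, j+1)` for `j + 1 < p`
  have hmid : (C (p : ℤ) : MvPolynomial (Fin 2) ℤ) ∣
      ∑ j ∈ range (p - 1), ((p.choose (j + 1) : ℕ) : ℤ) • (d₀ ^ (j + 1)) ((E ^ (p - (j + 1))) P) := by
    refine dvd_sum fun j hj => ?_
    have hjp : j + 1 < p := by
      have := mem_range.mp hj
      omega
    obtain ⟨q, hq⟩ : (p : ℤ) ∣ ((p.choose (j + 1) : ℕ) : ℤ) := by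
      exact_mod_cast hp.dvd_choose_self (Nat.succ_ne_zero j) hjp
    rw [hq, mul_smul, smul_eq_C_mul]
    exact dvd_mul_right _ _
  -- split off `j = 0` (the term `E^p P`) and `j = p` (the term `∂₀^p P`)
  have hsplit : royD^[p] P - X 1 * pderiv 1 P =
      ((E ^ p) P - E P) + (∑ j ∈ range (p - 1),
        ((p.choose (j + 1) : ℕ) : ℤ) • (d₀ ^ (j + 1)) ((E ^ (p - (j + 1))) P)) + (d₀ ^ p) P := by
    rw [hbin, sum_range_succ,
      show range p = range (p - 1 + 1) by rw [Nat.sub_add_cancel hp.one_lt.le], sum_range_succ',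
      Nat.choose_self, Nat.sub_self, Nat.choose_zero_right, Nat.sub_zero, pow_zero, pow_zero,
      Module.End.one_apply, Module.End.one_apply, Nat.cast_one, one_smul, one_smul, hE_apply]
    ring
  rw [hsplit]
  exact dvd_add (dvd_add (hB P) hmid) (hA P)

end Summit.Schanuel.Schanuel.Theorems

end
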